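import Mathlib
import HarnessLib
import Literature.AlgebraicGeometry.Resolution.RegularLocalRingsQuotient
import Literature.AlgebraicGeometry.Resolution.RegularLocalRingsUFD
import Summits.ResolutionOfSingularities.ResolutionOfSingularities.Theorems.HomologicalConductorPersistenceEdimBricks
import Summits.ResolutionOfSingularities.ResolutionOfSingularities.Theorems.HomologicalConductorPersistenceSurfaceSaturationResidualTwo

/-!
# Rung S-2 `PersistenceSurface` — the EDIM PRESENTATION (o9h): `edim = dim + 1` ⇒ abstract hypersurface

Route `ResolutionOfSingularities/HomologicalConductor`, chain W4.4b, rung S-2 `PersistenceSurface`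
(stmt-ResolutionOfSingularities-19970); o9/o11 lineage, object o9h (res-L1-w44b-plan-1 ORDER/ASSIGN
2026-08-27T08:21Z/08:56Z: «the edim form … so the residual reads edim T_m ≥ 4»).  [OURS · L1 w44b ·
res-type-011; AI-written, weaker than expert review; NOT a statement of the manuscript under study, and no
statement of that manuscript is used.]

* `isRegularHypersurfaceQuotient_of_surjective_of_ker_le_sq` — base step (`ker π ⊆ 𝔪_S²`): UFD
  (tree `IsRegularLocalRing.uniqueFactorizationMonoid`, Auslander–Buchsbaum) + brick (ii);
* `isRegularHypersurfaceQuotient_of_surjective` — **a local domain `T` of dimension `d` and embedding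
  dimension `d + 1` which is a quotient of a regular local ring is `≃+* R′ ⧸ (f)` with `R′` regular local
  of dimension `d + 1`, `f` a nonzerodivisor** (`IsRegularHypersurfaceQuotient d T`, o9g p515999);
  induction on `edim S` through `IsRegularLocalRing.quotient_span_singleton` (tree);
* `ca_subset_caAt_of_surjective_of_spanFinrank` — route vocabulary: such a stage `T ⊆ K` has
  `ca T ⊆ caAt n T` for `n ≥ d + 1` (o9g `ca_subset_caAt_of_isRegularHypersurfaceQuotient`, o9f, o9d).
So the `Sat₄` residual of the S-2 theorem shape is, for stages presented as quotients of regular local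
rings (all local rings essentially of finite type over the base field), exactly «normal singular with
embedding dimension `≥ 4`» (plus non-presented stages).
-/

noncomputable section

-- single-problem summit: the doubled namespace component `ResolutionOfSingularities` is forced
set_option linter.dupNamespace false

namespace Summit.ResolutionOfSingularities.ResolutionOfSingularities.Theorems.HomologicalConductor.PersistenceSurfaceSaturationEdimPresentation

open IsLocalRing Literature.AlgebraicGeometry.Resolution
open Summit.ResolutionOfSingularities.ResolutionOfSingularities.Theorems.HomologicalConductor.EdimBricks
open Summit.ResolutionOfSingularities.ResolutionOfSingularities.Theorems.HomologicalConductor.PersistenceSurfaceSaturationResidualTwo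
open scoped nonZeroDivisors

universe u

/-- **Presentation, base step.** Let `S` be a regular local ring, `π : S ↠ T` a surjection onto a
local DOMAIN `T` of Krull dimension `d` and embedding dimension `d + 1`, with `ker π ⊆ 𝔪_S²`. Then
`edim S = edim T = d + 1 = dim S` (brick (i), regularity), `ker π` is a nonzero prime, hence contains a
prime ELEMENT `q` (`S` is a UFD: tree `IsRegularLocalRing.uniqueFactorizationMonoid` = Auslander–Buchsbaum,
Matsumura Thm 20.3; Mathlib `Ideal.IsPrime.exists_mem_prime_of_ne_bot`); `S ⧸ (q)` is a local domain of
dimension `d` mapping onto `T`, so by brick (ii) the kernel `ker π ⧸ (q)` is zero: `ker π = (q)` and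
`T ≃+* S ⧸ (q)` — `T` is an abstract hypersurface `IsRegularHypersurfaceQuotient d T` (o9g). [OURS] -/
theorem isRegularHypersurfaceQuotient_of_surjective_of_ker_le_sq {S T : Type} [CommRing S]
    [IsRegularLocalRing S] [CommRing T] [IsDomain T] [IsLocalRing T] {d : ℕ}
    (hdim : ringKrullDim T = d) (hedim : (maximalIdeal T).spanFinrank = d + 1)
    (π : S →+* T) (hπ : Function.Surjective π) (hker : RingHom.ker π ≤ (maximalIdeal S) ^ 2) :
    IsRegularHypersurfaceQuotient d T := by
  haveI : IsDomain S := isDomain_of_isRegularLocalRing S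
  haveI : UniqueFactorizationMonoid S := IsRegularLocalRing.uniqueFactorizationMonoid S
  -- `dim S = edim S = edim T = d + 1`
  have hedimS : (maximalIdeal S).spanFinrank = d + 1 := by
    rw [← spanFinrank_maximalIdeal_eq_of_surjective_of_ker_le_sq π hπ hker, hedim]
  have hdimS : ringKrullDim S = (d + 1 : ℕ) := by
    rw [← IsRegularLocalRing.spanFinrank_maximalIdeal, hedimS]
  -- `J = ker π` is a nonzero prime
  have hJprime : (RingHom.ker π).IsPrime := RingHom.ker_isPrime π
  have hJtop : RingHom.ker π ≠ ⊤ := hJprime.ne_top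
  have hJne : RingHom.ker π ≠ ⊥ := by
    intro hJ
    have hinj : Function.Injective π := (RingHom.injective_iff_ker_eq_bot π).mpr hJ
    have e : S ≃+* T := RingEquiv.ofBijective π ⟨hinj, hπ⟩
    have := ringKrullDim_eq_of_ringEquiv e
    rw [hdimS, hdim] at this
    have h' : (d + 1 : ℕ) = d := by exact_mod_cast this
    omega
  -- a prime element `q ∈ J`
  obtain ⟨q, hqJ, hq⟩ := hJprime.exists_mem_prime_of_ne_bot hJne
  have hq0 : q ≠ 0 := hq.ne_zero
  have hqm : q ∈ maximalIdeal S := le_maximalIdeal hJtop hqJ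
  have hqreg : q ∈ S⁰ := mem_nonZeroDivisors_of_ne_zero hq0
  -- `D = S ⧸ (q)`: a local noetherian domain of dimension `d`
  haveI hDloc : IsLocalRing (S ⧸ Ideal.span {q}) :=
    isLocalRing_quotient (Ideal.span_singleton_ne_top (hq.not_unit))
  haveI : IsDomain (S ⧸ Ideal.span {q}) :=
    (Ideal.Quotient.isDomain_iff_prime _).mpr ((Ideal.span_singleton_prime hq0).mpr hq)
  have hDdim1 := ringKrullDim_quotient_span_singleton_succ_eq_ringKrullDim_of_mem_nonZeroDivisors
    hqreg hqm
  have hDle : ringKrullDim (S ⧸ Ideal.span {q}) ≤ (d + 1 : ℕ) := by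
    rw [← hdimS]; exact ringKrullDim_quotient_le _
  obtain ⟨e₀, he₀, -⟩ := exists_ringKrullDim_eq_nat_of_le hDle
  have hDdim : ringKrullDim (S ⧸ Ideal.span {q}) = d := by
    rw [he₀, hdimS] at hDdim1
    have : e₀ + 1 = d + 1 := by exact_mod_cast hDdim1
    rw [he₀]
    exact_mod_cast (by omega : e₀ = d)
  -- `J' = J / (q)` is a prime of `D` with `D / J' ≅ T`
  have hle : Ideal.span {q} ≤ RingHom.ker π := (Ideal.span_singleton_le_iff_mem _).mpr hqJ
  set J' : Ideal (S ⧸ Ideal.span {q}) := (RingHom.ker π).map (Ideal.Quotient.mk (Ideal.span {q}))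
  have eT : (S ⧸ Ideal.span {q}) ⧸ J' ≃+* T :=
    (DoubleQuot.quotQuotEquivQuotOfLE hle).trans (RingHom.quotientKerEquivOfSurjective hπ)
  have hJ' : J' = ⊥ := by
    by_contra hJ'ne
    have hJ'top : J' ≠ ⊤ := by
      intro htop
      have : Subsingleton ((S ⧸ Ideal.span {q}) ⧸ J') :=
        Ideal.Quotient.subsingleton_iff.mpr htop
      have : Subsingleton T := eT.symm.toEquiv.subsingleton
      exact false_of_nontrivial_of_subsingleton T
    have h1 := ringKrullDim_quotient_add_one_le_of_ne_bot hJ'ne hJ'top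
    rw [ringKrullDim_eq_of_ringEquiv eT, hdim, hDdim] at h1
    have : d + 1 ≤ d := by exact_mod_cast h1
    omega
  -- hence `J = (q)` and `T ≃+* S ⧸ (q)`
  have hJeq : RingHom.ker π = Ideal.span {q} := by
    refine le_antisymm ?_ hle
    rw [← Ideal.mk_ker (I := Ideal.span {q}), ← Ideal.map_eq_bot_iff_le_ker]
    exact hJ'
  exact ⟨S, inferInstance, inferInstance, hdimS, q, hqreg,
    ⟨(RingHom.quotientKerEquivOfSurjective hπ).symm.trans (Ideal.quotEquivOfEq hJeq)⟩⟩

/-- **The presentation lemma (o9h): embedding dimension `dim + 1` ⇒ abstract hypersurface.** Let `T`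
be a local domain of Krull dimension `d` and embedding dimension `spanFinrank 𝔪_T = d + 1` that is a
quotient of SOME regular local ring `S` (e.g. every local ring essentially of finite type over a field).
Then `T ≃+* R′ ⧸ (f)` for a regular local `R′` of dimension `d + 1` and a nonzerodivisor `f`:
`IsRegularHypersurfaceQuotient d T`.  Induction on `edim S`: if `ker π ⊄ 𝔪_S²`, pick
`x ∈ ker π ∖ 𝔪_S²`, replace `S` by the regular local ring `S ⧸ (x)` of embedding dimension one less (tree
`IsRegularLocalRing.quotient_span_singleton`, `…spanFinrank_maximalIdeal_quotient_span_singleton`) and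
factor `π` through it; otherwise the base step applies. With o9g/o9f/o9d this discharges the `Sat₄` clause
at every tower stage PRESENTED as such a quotient with `edim T_m ≤ 3` — the residual reads «`edim ≥ 4`».
[OURS] -/
theorem isRegularHypersurfaceQuotient_of_surjective {T : Type} [CommRing T] [IsDomain T]
    [IsLocalRing T] {d : ℕ} (hdim : ringKrullDim T = d)
    (hedim : (maximalIdeal T).spanFinrank = d + 1) :
    ∀ (n : ℕ) (S : Type) [CommRing S] [IsRegularLocalRing S],
      (maximalIdeal S).spanFinrank = n → ∀ (π : S →+* T), Function.Surjective π →
        IsRegularHypersurfaceQuotient d T := by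
  intro n
  induction n with
  | zero =>
    intro S _ _ hn π hπ
    refine isRegularHypersurfaceQuotient_of_surjective_of_ker_le_sq hdim hedim π hπ ?_
    -- `𝔪_S = ⊥`, so `ker π ≤ 𝔪_S = ⊥ ≤ 𝔪²`
    have hm : maximalIdeal S = ⊥ :=
      (Submodule.spanFinrank_eq_zero_iff_eq_bot (IsNoetherian.noetherian _)).mp hn
    intro x hx
    have : x ∈ maximalIdeal S := le_maximalIdeal (RingHom.ker_ne_top π) hx
    rw [hm] at this
    rw [(Submodule.mem_bot S).mp this]
    exact zero_mem _
  | succ n ih =>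
    intro S _ _ hn π hπ
    by_cases hker : RingHom.ker π ≤ (maximalIdeal S) ^ 2
    · exact isRegularHypersurfaceQuotient_of_surjective_of_ker_le_sq hdim hedim π hπ hker
    · -- pick `x ∈ ker π ∖ 𝔪²` and pass to `S ⧸ (x)`
      obtain ⟨x, hxJ, hx2⟩ := Set.not_subset.mp hker
      have hxm : x ∈ maximalIdeal S := le_maximalIdeal (RingHom.ker_ne_top π) hxJ
      haveI := (IsRegularLocalRing.quotient_span_singleton hxm hx2).1
      have hn' : (maximalIdeal (S ⧸ Ideal.span {x})).spanFinrank = n := by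
        have := IsRegularLocalRing.spanFinrank_maximalIdeal_quotient_span_singleton hxm hx2
        rw [hn] at this
        omega
      have hle : Ideal.span {x} ≤ RingHom.ker π := (Ideal.span_singleton_le_iff_mem _).mpr hxJ
      let π₁ : S ⧸ Ideal.span {x} →+* T :=
        Ideal.Quotient.lift (Ideal.span {x}) π (fun a ha => (RingHom.mem_ker).mp (hle ha))
      have hπ₁ : Function.Surjective π₁ :=
        Ideal.Quotient.lift_surjective_of_surjective (Ideal.span {x}) _ hπ
      exact ih (S ⧸ Ideal.span {x}) hn' π₁ hπ₁


/-- **Route vocabulary**: a subalgebra stage `T ⊆ K` whose ring `↥T` is a local domain of dimension `d`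
and embedding dimension `d + 1`, presented as a quotient of a regular local ring, satisfies
`ca T ⊆ caAt n T` for every `n ≥ d + 1` (surface towers: `d = 2`, `n = 4`). [OURS] -/
theorem ca_subset_caAt_of_surjective_of_spanFinrank {k K : Type} [Field k] [Field K] [Algebra k K]
    (T : Subalgebra k K) [IsLocalRing ↥T] (hdom : IsDomain ↥T) {d : ℕ}
    (hdim : ringKrullDim ↥T = d) (hedim : (maximalIdeal ↥T).spanFinrank = d + 1) {S : Type}
    [CommRing S] [IsRegularLocalRing S] (π : S →+* ↥T) (hπ : Function.Surjective π) {n : ℕ}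
    (hn : d + 1 ≤ n) :
    {x : K | ∃ hx : x ∈ T, ∃ m : ℕ, ∀ i : ℕ, m ≤ i → ∀ (M N : ModuleCat.{0} ↥T),
        Module.Finite ↥T M → Module.Finite ↥T N →
          ∀ e : CategoryTheory.Abelian.Ext.{0} M N i, (⟨x, hx⟩ : ↥T) • e = 0} ⊆
      {x : K | ∃ hx : x ∈ T, ∀ i : ℕ, n ≤ i → ∀ (M N : ModuleCat.{0} ↥T),
        Module.Finite ↥T M → Module.Finite ↥T N →
          ∀ e : CategoryTheory.Abelian.Ext.{0} M N i, (⟨x, hx⟩ : ↥T) • e = 0} :=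
  haveI := hdom
  ca_subset_caAt_of_isRegularHypersurfaceQuotient T
    (isRegularHypersurfaceQuotient_of_surjective hdim hedim _ S rfl π hπ) hn

end Summit.ResolutionOfSingularities.ResolutionOfSingularities.Theorems.HomologicalConductor.PersistenceSurfaceSaturationEdimPresentation

end
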